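import Summits.CriticalPhenomena.PercolationContinuityZ3.Theorems.PercNearOneGluingNoHeavyLowerTailKnQuestion8CoefficientwiseRemPieceRows
import HarnessLib

/-!
# The piece classes `R0`, `R1`, `N` and the class 𝒰 of THEOREM U3-CLOSURE — definitions and the top reduction `(D;x,p) ∈ 𝒰 ⇒ REM(e ∥ D) ≥ 0` — prim-lf-2 gen 69

Support/definition file (`--supports stmt-CriticalPhenomena-4575`, closed), prover `prim-lf-2` (gen 69).  Definitions + their basic API; no named facts, no sorries;
standard axioms.  Memo `prim-lf-2/CW-SP-gen69.md` §1, §2, §4 (THEOREM U3-CLOSURE), §8(1) (Lean plan).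

Setting: multigraph `ends : ι → Sym2 V`; a PIECE is an edge set `D` with two terminals `x` (root side) and `h`; for a colouring `t ⊆ D` write `A^x = C_x(t)`, `A^h = C_h(t)`,
`B^x = C_x(D∖t)`, `B^h = C_h(D∖t)` (`C_a(s) = openCluster (ends '' s) a`); `W` is a target set (targets other than `h` that matter are the internal ones).
* `Coefficientwise.pieceR0 / pieceR1 / pieceN` — the three colouring classes of memo §1/§0(ii): `R0` = `h ∈ A^x`, `h ∉ B^x`, no target in `A^x ∩ B^x`, no target `≠ h` in
  `A^x ∩ B^h`; `R1` = the same but SOME target `≠ h` in `A^x ∩ B^h`; `N` = `h ∉ A^x ∪ B^x`, no target in `A^x ∩ B^x`, none in `A^h ∩ B^x`, some in `A^x ∩ B^h`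
  (these are literally the filters of `rem_nonneg_of_pieceRows_union`).
* `Coefficientwise.HasDomRow ends D x cls` — the ROW of a class: a map `π` sending the class into itself injectively with `C_x(D∖t) ⊆ C_x(π t)` (strong domination).
* `Coefficientwise.InU3 ends D x h` — `(D;x,h) ∈ 𝒰`: for every target set `W`, the classes `R0`, `R1`, `N` have rows.  CONJECTURE U3 (memo §6): every piece is in 𝒰;
  THEOREM U3-CLOSURE (memo §4.2, Lean to follow): 𝒰 ∋ edge is closed under series and parallel composition (⇒ all two-terminal series–parallel pieces are in 𝒰).
* `Coefficientwise.sum_nonneg_of_hasDomRow` — a row gives the linear inequality `0 ≤ Σ_class (g(C_x t ∪ C_h t) − g(C_x(D∖t)))` for monotone `g`.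
* `Coefficientwise.rem_nonneg_of_inU3` — **(D;x,p) ∈ 𝒰 for `D = E.erase e` ⇒ `REM_E(e;x,W)[g] ≥ 0` for every `W` and monotone `g`** (via `rem_nonneg_of_pieceRows_union`).
[cite: KozmaNitzan2024, Questions 8–9 (§5.5 p. 36) (context: the Question-8 pocket covariance programme)]
-/

namespace Summit.CriticalPhenomena.PercolationContinuityZ3.Theorems

open Finset Literature.Probability.Percolation

namespace Coefficientwise

variable {ι V : Type*} [DecidableEq ι] (ends : ι → Sym2 V)

section defs

variable (D : Finset ι) (x h : V) (W : Set V)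

/-- Class `R0` of the piece `(D;x,h)` with targets `W`: `h` red-joined (not blue-joined) to `x`, no target in `C_x t ∩ C_x(D∖t)`, no target `≠ h` in `C_x t ∩ C_h(D∖t)`. -/
def pieceR0 (t : Finset ι) : Prop :=
  h ∈ openCluster (ends '' (↑t : Set ι)) x ∧ h ∉ openCluster (ends '' (↑(D \ t) : Set ι)) x ∧
  (∀ w ∈ W, ¬ (w ∈ openCluster (ends '' (↑t : Set ι)) x ∧ w ∈ openCluster (ends '' (↑(D \ t) : Set ι)) x)) ∧
  (∀ w ∈ W, w ≠ h → ¬ (w ∈ openCluster (ends '' (↑t : Set ι)) x ∧ w ∈ openCluster (ends '' (↑(D \ t) : Set ι)) h))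

/-- Class `R1`: as `R0` but SOME target `≠ h` lies in `C_x t ∩ C_h(D∖t)` (a red-cluster target hangs blue from `h`). -/
def pieceR1 (t : Finset ι) : Prop :=
  h ∈ openCluster (ends '' (↑t : Set ι)) x ∧ h ∉ openCluster (ends '' (↑(D \ t) : Set ι)) x ∧
  (∀ w ∈ W, ¬ (w ∈ openCluster (ends '' (↑t : Set ι)) x ∧ w ∈ openCluster (ends '' (↑(D \ t) : Set ι)) x)) ∧
  (∃ w ∈ W, w ≠ h ∧ w ∈ openCluster (ends '' (↑t : Set ι)) x ∧ w ∈ openCluster (ends '' (↑(D \ t) : Set ι)) h)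

/-- Class `N` (the union class `ResN` of the memo): `h` in neither `C_x t` nor `C_x(D∖t)`, no target in `C_x t ∩ C_x(D∖t)`, none in `C_h t ∩ C_x(D∖t)`, some in
`C_x t ∩ C_h(D∖t)`. -/
def pieceN (t : Finset ι) : Prop :=
  h ∉ openCluster (ends '' (↑t : Set ι)) x ∧ h ∉ openCluster (ends '' (↑(D \ t) : Set ι)) x ∧
  (∀ w ∈ W, ¬ (w ∈ openCluster (ends '' (↑t : Set ι)) x ∧ w ∈ openCluster (ends '' (↑(D \ t) : Set ι)) x)) ∧
  (∀ w ∈ W, ¬ (w ∈ openCluster (ends '' (↑t : Set ι)) h ∧ w ∈ openCluster (ends '' (↑(D \ t) : Set ι)) x)) ∧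
  (∃ w ∈ W, w ∈ openCluster (ends '' (↑t : Set ι)) x ∧ w ∈ openCluster (ends '' (↑(D \ t) : Set ι)) h)

/-- A (strong) ROW for a class `cls` of colourings of the piece `D` with root terminal `x`: a map of the class into itself, injective on the class, with
`C_x(D∖t) ⊆ C_x(π t)` — by finiteness a dominating bijection of the class (Strassen coupling `A^x ≽ B^x`). -/
def HasDomRow (cls : Finset ι → Prop) : Prop :=
  ∃ π : Finset ι → Finset ι,
    (∀ t, t ⊆ D → cls t → (π t ⊆ D ∧ cls (π t))) ∧
    (∀ t₁ t₂, t₁ ⊆ D → cls t₁ → t₂ ⊆ D → cls t₂ → π t₁ = π t₂ → t₁ = t₂) ∧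
    (∀ t, t ⊆ D → cls t → openCluster (ends '' (↑(D \ t) : Set ι)) x ⊆ openCluster (ends '' (↑(π t) : Set ι)) x)

/-- `(D; x, h) ∈ 𝒰` (memo CW-SP-gen69 §0(iv)): for every target set, the classes `R0`, `R1`, `N` admit rows.  CONJECTURE U3: always; THEOREM: for all two-terminal
series–parallel pieces (paper, machine-certified; Lean in progress). -/
def InU3 : Prop :=
  ∀ W : Set V, HasDomRow ends D x (pieceR0 ends D x h W) ∧ HasDomRow ends D x (pieceR1 ends D x h W) ∧ HasDomRow ends D x (pieceN ends D x h W)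

end defs

section api

open Classical in
/-- A row yields the linear inequality: for monotone `g`, `0 ≤ Σ_{t ⊆ D, cls t} (g(C_x t ∪ C_h t) − g(C_x(D∖t)))`.
[cite: KozmaNitzan2024, Questions 8–9 (§5.5 p. 36) (context)] -/
theorem sum_nonneg_of_hasDomRow (D : Finset ι) (x h : V) (cls : Finset ι → Prop) (hrow : HasDomRow ends D x cls)
    (g : Set V → ℝ) (hg : Monotone g) :
    0 ≤ ∑ t ∈ D.powerset.filter (fun t => cls t),
      (g (openCluster (ends '' (↑t : Set ι)) x ∪ openCluster (ends '' (↑t : Set ι)) h) - g (openCluster (ends '' (↑(D \ t) : Set ι)) x)) := by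
  obtain ⟨π, hmaps, hinj, hdom⟩ := hrow
  set T : Finset (Finset ι) := D.powerset.filter (fun t => cls t) with hT
  have hmemT : ∀ t, t ∈ T ↔ (t ⊆ D ∧ cls t) := by
    intro t; simp only [hT, Finset.mem_filter, Finset.mem_powerset]
  -- reindex Σ g(C_x(π t) ∪ C_h(π t)) = Σ g(C_x t ∪ C_h t)
  set G : Finset ι → ℝ := fun t => g (openCluster (ends '' (↑t : Set ι)) x ∪ openCluster (ends '' (↑t : Set ι)) h) with hG
  have hmapsT : ∀ t (ht : t ∈ T), π t ∈ T := by
    intro t ht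
    obtain ⟨htD, hct⟩ := (hmemT t).mp ht
    exact (hmemT _).mpr (hmaps t htD hct)
  have hinjT : ∀ t₁ (h₁ : t₁ ∈ T) t₂ (h₂ : t₂ ∈ T), π t₁ = π t₂ → t₁ = t₂ := by
    intro t₁ h₁ t₂ h₂ he
    obtain ⟨h1D, h1c⟩ := (hmemT t₁).mp h₁
    obtain ⟨h2D, h2c⟩ := (hmemT t₂).mp h₂
    exact hinj t₁ t₂ h1D h1c h2D h2c he
  have hsurjT : ∀ s ∈ T, ∃ t, ∃ ht : t ∈ T, π t = s := by
    intro s hs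
    obtain ⟨t, ht, hts⟩ := Finset.surj_on_of_inj_on_of_card_le (fun t (_ : t ∈ T) => π t) (fun t ht => hmapsT t ht)
      (fun t₁ t₂ h₁ h₂ he => hinjT t₁ h₁ t₂ h₂ he) le_rfl s hs
    exact ⟨t, ht, hts.symm⟩
  have hre : ∑ t ∈ T, G (π t) = ∑ t ∈ T, G t := by
    refine Finset.sum_bij (fun t _ => π t) (fun t ht => hmapsT t ht) (fun t₁ h₁ t₂ h₂ he => hinjT t₁ h₁ t₂ h₂ he) ?_ (fun _ _ => rfl)
    intro s hs
    obtain ⟨t, ht, hts⟩ := hsurjT s hs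
    exact ⟨t, ht, hts⟩
  have hle : ∑ t ∈ T, g (openCluster (ends '' (↑(D \ t) : Set ι)) x) ≤ ∑ t ∈ T, G (π t) := by
    refine Finset.sum_le_sum fun t ht => ?_
    obtain ⟨htD, hct⟩ := (hmemT t).mp ht
    exact hg ((hdom t htD hct).trans Set.subset_union_left)
  rw [hre] at hle
  rw [Finset.sum_sub_distrib]
  linarith

open Classical in
/-- **`(D;x,p) ∈ 𝒰` for `D = E.erase e` implies (REM) for every target set.**  For a root edge `e ∈ E` with ends `{x,p}`, `p ≠ x`: if `InU3 ends (E.erase e) x p` then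
`0 ≤ REM_E(e; x, W)[g]` for every `W` and monotone `g` (THEOREM 0, union form, fed with the linear inequalities of the three rows).
[cite: KozmaNitzan2024, Questions 8–9 (§5.5 p. 36) (context)] -/
theorem rem_nonneg_of_inU3 (E : Finset ι) {e : ι} (he : e ∈ E) {x p : V} (hxp : ends e = s(x, p)) (hpx : p ≠ x)
    (hU : InU3 ends (E.erase e) x p) (W : Set V) (g : Set V → ℝ) (hg : Monotone g) :
    0 ≤ ∑ s ∈ E.powerset.filter (fun s : Finset ι => e ∈ s ∧
          ∀ w ∈ W, ¬ (w ∈ openCluster (ends '' (↑s : Set ι)) x ∧ w ∈ openCluster (ends '' (↑(E \ s) : Set ι)) x)),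
      (g (openCluster (ends '' (↑s : Set ι)) x) - g (openCluster (ends '' (↑(E \ s) : Set ι)) x)) := by
  obtain ⟨hR0, hR1, hN⟩ := hU W
  have h0 := sum_nonneg_of_hasDomRow ends (E.erase e) x p _ hR0 g hg
  have h1 := sum_nonneg_of_hasDomRow ends (E.erase e) x p _ hR1 g hg
  have h2 := sum_nonneg_of_hasDomRow ends (E.erase e) x p _ hN g hg
  refine rem_nonneg_of_pieceRows_union ends E he hxp hpx W g hg ?_ (fun _ => ?_) ?_
  · refine le_of_le_of_eq h1 (Finset.sum_congr (Finset.filter_congr fun t _ => ?_) fun _ _ => rfl)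
    simp only [pieceR1]
  · refine le_of_le_of_eq h0 (Finset.sum_congr (Finset.filter_congr fun t _ => ?_) fun _ _ => rfl)
    simp only [pieceR0]
  · refine le_of_le_of_eq h2 (Finset.sum_congr (Finset.filter_congr fun t _ => ?_) fun _ _ => rfl)
    simp only [pieceN]

end api

end Coefficientwise

end Summit.CriticalPhenomena.PercolationContinuityZ3.Theorems
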